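import Summits.BirchSwinnertonDyer.BirchSwinnertonDyer.Theses.SchneiderFreeAdditiveX3
import Summits.BirchSwinnertonDyer.Rank1Residual.AdditivePotMult.RankOneHeegner
import Summits.BirchSwinnertonDyer.Rank1Residual.AdditivePotMult.TwistSupplyJ
import Summits.BirchSwinnertonDyer.Rank1Residual.Additive.GordTwistMinimalModel
import Summits.BirchSwinnertonDyer.Rank1Residual.X11b.TwistTransportRam
import Summits.BirchSwinnertonDyer.Rank1Residual.X11b.TwistTransportIrr
import Summits.BirchSwinnertonDyer.Rank1Residual.X11b.Three.StepLAtThree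
import Literature.NumberTheory.EllipticCurves.BSDHeegnerPointsGrossZagierProofs
import Literature.NumberTheory.EllipticCurves.KrizLi2019.SexticTwistBSDThreeDescent
import Literature.NumberTheory.EllipticCurves.GlobalMinimalModelProofs
import HarnessLib

/-!
# Route `SchneiderFreeAdditiveX3` (rung K1 door, cell `bsd-schneider-ideate`): the support `HeegnerTwistData` PROVED

Item `stmt-BirchSwinnertonDyer-19183` of route `route-BirchSwinnertonDyer-SchneiderFreeAdditiveX3`
(`Theses/SchneiderFreeAdditiveX3.lean`, rev 3, support, rank 9): from six printed facts carried as
explicit antecedents — Friedberg–Hoffstein Thm. B with prescribed splitting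
(`friedbergHoffstein_exists_heegnerField_splitDivisors_twist_ne_zero`), the parity fact
(`even_analyticRank_iff_rootNumber_eq_one`), Heegner points over `K` (`exists_isHeegnerPoint`),
Gross–Zagier (`gross_zagier`), modularity (`hasEntireLFunction_rat`) and a parametrisation datum
(`nonempty_modularParametrizationData`, not needed) — the Manin-robust Heegner/twist data
`SchneiderFree.HeegnerTwistDataManinAt W p` for every pair on the cells (`r_an(E) = 1`, `p` odd,
`ClassX3 W p`, `Additive.SubSemistableTwist W p`).

§1 Transports (the rank-zero Heegner twist of a pair on the cells is a pair on the cells). The tree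
predicate asks for a globally minimal model `Wd = Cd • E^{(d_K)}` of the twist by a Heegner field `K`
(every `ℓ ∣ N_E` split, so the additive `p` splits: `d_K ∈ (ℚ_p^×)²`, `p ∤ d_K`) lying on the SAME
cells: `ClassX3 Wd p` (`E^{d_K}[p]` reducible, additive at `p`) and `Additive.SubSemistableTwist Wd p`
((M): `ord_p j < 0`; or (G-ord, `e = 2`): `¬(M) ∧ f_p = 2 ∧ e ∣ p − 1 ∧ e = 2`,
`e = 12/gcd(12, ord_p Δ_min)`). Four elementary transports:
* `red_twist_of_quadratic` — `E[p]` reducible ⟹ `E^{(d_K)}[p]` reducible (`(E^{d})^{d} ≅ E` and the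
  tree's irreducibility transport `X11b.hasIrreducibleModPGaloisRep_quadraticTwist`);
* `condExp_twist_of_heegner_eq` — `f_p(E^{(d_K)}) = f_p(E)` (`d_K = 4k + 1` with `p ∤ d_K`: the twist
  is UNRAMIFIED at `p`, tree `conductorExponent_twistModel` + `conductorExponent_smul'`);
* `subSemistableTwist_twist_of_heegner` — (M) / (G-ord, `e = 2`) transport (`j` is a twist invariant,
  `ord_p Δ_min` by `X11b.padicValInt_minimalDiscriminantInt_twist_eq`, `f_p` by the previous);
* `classX3_twist_of_heegner` — `ClassX3` transports (`AdditivePotMult.addv_iff_of_twist` + the first).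

§2 The item. `r_an = 1` is odd, so `w(E) = −1` (parity); Friedberg–Hoffstein with the auxiliary
`M = 2` gives an imaginary quadratic `K` with the Heegner hypothesis for `N_E` AND `2` split — hence
`d_K ≡ 1 (mod 8)` is odd (`SatisfiesHeegnerHypothesis.discr_emod_eight`) — and `L(E^{d_K},1) ≠ 0`; the
additive `p ∣ N_E` splits, so `p ∤ d_K` and `p ∤ #𝓞_K^×`
(`X11b.Three.not_dvd_discr_and_not_dvd_torsionOrder_of_heegner`); `exists_isHeegnerPoint` supplies the
parametrisation datum, the Heegner datum, the embedding and the Heegner point `P ∈ E(K)`, which is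
non-torsion by Gross–Zagier since `L'(E/K,1) = L'(E,1)·L(E^{d_K},1) ≠ 0`
(`lDerivEK_ne_zero_iff_not_isOfFinAddOrder`, `lDerivEK_eq_deriv_mul`); a globally minimal model `Wd` of
the twist exists (`hasGlobalMinimalModel_rat_holds`), has `r_an(Wd) = 0`, and lies on the same cells
(§1). NO condition on the parametrisation constant appears (rev 3, FINDING cacd1ba6 of the cell).

THEOREMS ONLY; the published inputs are binders of the item. HONEST FRAMING: closes a support item of a
DRAFT route; the rung leaf `AdditiveX3RankOneLower` and BSD are NOT claimed.

References: [FriedbergHoffstein1995] Thm. B; [JetchevSkinnerWan2017] §7.4.1 (p. 30);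
[GrossZagier1986] Thm. I.(6.3); [Gross1991] (1.1); [SilvermanAEC2009] X.5 Cor. 5.4, VII.1 Prop. 1.3;
[SilvermanATAEC1994] IV.9.4.
-/

noncomputable section

open scoped Classical

open WeierstrassCurve NumberField IsDedekindDomain IsDedekindDomain.HeightOneSpectrum
  Rat.HeightOneSpectrum
  Literature.NumberTheory.EllipticCurves
  Literature.NumberTheory.EllipticCurves.ModularForms
  Literature.NumberTheory.EllipticCurves.Rank1Residual
  Literature.NumberTheory.QuadraticFields
  Summit.BirchSwinnertonDyer.Rank1Residual

namespace Summit.BirchSwinnertonDyer.BirchSwinnertonDyer.Theorems.SchneiderFree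

/-! ### §1 Transports along the Heegner twist -/

/-! #### Reducibility of `E[p]` along a quadratic twist -/

/-- **`E[p]` reducible ⟹ `E^{(d_K)}[p]` reducible** for a quadratic field `K` and any `ℚ`-model
`Wd = Cd • W^{(d_K)}` of the twist: `(W^{(d)})^{(d)} = W^{(d²)} ≅ W`, so an irreducible `Wd[p]` would
transport back to `W[p]` by the tree's `X11b.hasIrreducibleModPGaloisRep_quadraticTwist`
(`d_K` is not a rational square). [cite: SilvermanAEC2009, X.5 Cor. 5.4] -/
theorem red_twist_of_quadratic (W : WeierstrassCurve ℚ) (p : ℕ) [Fact p.Prime] (K : Type) [Field K]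
    [NumberField K] (h2 : Module.finrank ℚ K = 2) (hred : Red W p) {Wd : WeierstrassCurve ℚ}
    (Cd : VariableChange ℚ) (hWd : Cd • W.quadraticTwist (NumberField.discr K : ℚ) = Wd) :
    Red Wd p := by
  intro hirr
  apply hred
  haveI : NeZero (2 : ℚ) := ⟨two_ne_zero⟩
  set d : ℚ := (NumberField.discr K : ℚ) with hd_def
  have hd0 : d ≠ 0 := by rw [hd_def]; exact_mod_cast NumberField.discr_ne_zero K
  have hnsq : ¬ IsSquare d := X11b.not_isSquare_discr_of_finrank_eq_two K h2
  -- `Wd[p]` irreducible ⟹ `(W^{(d)})[p]` irreducible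
  have h1 : (W.quadraticTwist d).HasIrreducibleModPGaloisRep p := by
    rw [← Mazur1978.hasIrreducibleModPGaloisRep_smul_iff (W.quadraticTwist d) Cd p, hWd]
    exact hirr
  -- ⟹ `((W^{(d)})^{(d)})[p]` irreducible
  have h2' := X11b.hasIrreducibleModPGaloisRep_quadraticTwist (W.quadraticTwist d) hnsq p h1
  -- and `(W^{(d)})^{(d)} = W^{(d²)} = D • W`
  obtain ⟨D, hD⟩ := W.exists_variableChange_smul_eq_quadraticTwist_sq hd0
  rw [quadraticTwist_quadraticTwist, ← sq, ← hD, Mazur1978.hasIrreducibleModPGaloisRep_smul_iff] at h2'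
  exact h2'

/-! #### The conductor exponent at `p` along the Heegner twist -/

variable (p : ℕ) [hp : Fact p.Prime]

/-- **`f_p(E^{(d_K)}) = f_p(E)` when `d_K` is odd and `p ∤ d_K`** (`p` odd): `d_K ≡ 1 (mod 4)`
(fundamental discriminant), so `E^{(d_K)} ≅ E.twistModel k` with `d_K = 4k + 1`
(`exists_variableChange_twistModel_eq_quadraticTwist`), the twist is unramified at `p`
(`|k|_p ≤ 1`, `|4k+1|_p = 1`), and Ogg's `f_p` agrees on the twist model (`conductorExponent_twistModel`)
and is an isomorphism invariant (`conductorExponent_smul'`). [cite: SilvermanATAEC1994, IV.9.4 (PDF pp. 344–346)] -/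
theorem condExp_twist_of_heegner_eq (W : WeierstrassCurve ℚ) [W.IsElliptic]
    (K : Type) [Field K] [NumberField K] (hK : IsImaginaryQuadratic K) (hodd : Odd (NumberField.discr K))
    (hpd : ¬ (p : ℤ) ∣ NumberField.discr K) {Wd : WeierstrassCurve ℚ} [Wd.IsElliptic]
    (Cd : VariableChange ℚ) (hWd : Cd • W.quadraticTwist (NumberField.discr K : ℚ) = Wd) :
    Additive.condExp Wd p = Additive.condExp W p := by
  set d : ℤ := NumberField.discr K with hd_def
  have hdZ : d ≠ 0 := NumberField.discr_ne_zero K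
  have hD0 : (d : ℚ) ≠ 0 := by exact_mod_cast hdZ
  -- `d_K = 4k + 1`
  have h4 : d = 4 * (d / 4) + 1 := by
    rcases Quadratic.isFundamentalDiscriminant_discr (K := K) hK.1 with ⟨h1, -, -⟩ | ⟨h4, -, -⟩
    · omega
    · exfalso
      obtain ⟨k, hk⟩ := h4
      obtain ⟨m, hm⟩ := hodd
      omega
  set k : ℤ := d / 4 with hk_def
  have hkq : (4 * (k : ℚ) + 1) = (d : ℚ) := by exact_mod_cast h4.symm
  obtain ⟨C₁, -, hC₁⟩ := exists_variableChange_twistModel_eq_quadraticTwist W (k : ℚ)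
  rw [hkq] at hC₁
  haveI : (W.twistModel (k : ℚ)).IsElliptic := by
    refine ⟨?_⟩
    rw [twistModel_Δ]
    exact (IsUnit.mk0 _ (pow_ne_zero 6 (by rw [hkq]; exact hD0))).mul W.isUnit_Δ
  haveI : (W.quadraticTwist (d : ℚ)).IsElliptic := W.isElliptic_quadraticTwist hD0
  unfold Additive.condExp
  rw [← hWd, conductorExponent_smul', ← hC₁, conductorExponent_smul']
  refine conductorExponent_twistModel (Additive.placeOf p) W ?_ ?_
  · rw [show (k : ℚ) = algebraMap ℤ ℚ k from (eq_intCast _ k).symm]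
    exact HeightOneSpectrum.valuation_le_one (Additive.placeOf p) k
  · rw [show (4 * (k : ℚ) + 1 : ℚ) = ((4 * k + 1 : ℤ) : ℚ) by push_cast; ring,
      Literature.NumberTheory.EllipticCurves.Rat.valuation_intCast_eq_one_iff,
      Additive.natGenerator_placeOf_eq, ← h4]
    exact hpd

/-! #### The cells transport -/

/-- **(M) / (G-ord, `e = 2`) transports along the Heegner twist**: for a pair `(E, p)`, `p` odd and
additive for `E`, an imaginary quadratic `K` with odd `d_K` satisfying the Heegner hypothesis for
`N_E` (so `p ∣ N_E` splits: `d_K ∈ (ℚ_p^×)²`, `p ∤ d_K`) and a globally minimal model `Wd` of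
`E^{(d_K)}`: `SubSemistableTwist W p → SubSemistableTwist Wd p` — `j(Wd) = j(W)`, `ord_p Δ_min` agree
(`ℚ_p`-isomorphic minimal models), `f_p` agree. [cite: SilvermanAEC2009, X.5 Cor. 5.4 and VII.1 Prop. 1.3(b)] -/
theorem subSemistableTwist_twist_of_heegner (W : WeierstrassCurve ℚ) [W.IsElliptic]
    [W.IsGloballyMinimal] (hp2 : p ≠ 2) (K : Type) [Field K] [NumberField K]
    (hK : IsImaginaryQuadratic K) (hodd : Odd (NumberField.discr K))
    (hHN : SatisfiesHeegnerHypothesis (W.conductorNorm ℤ) K) (hadd : Addv W p)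
    {Wd : WeierstrassCurve ℚ} [Wd.IsElliptic] [Wd.IsGloballyMinimal] (Cd : VariableChange ℚ)
    (hWd : Cd • W.quadraticTwist (NumberField.discr K : ℚ) = Wd)
    (hS : Additive.SubSemistableTwist W p) : Additive.SubSemistableTwist Wd p := by
  have hD0 : (NumberField.discr K : ℚ) ≠ 0 := by exact_mod_cast NumberField.discr_ne_zero K
  have hpN : p ∣ W.conductorNorm ℤ :=
    (W.dvd_conductorNorm_iff_not_hasGoodReductionAtPrime p).mpr hadd.1
  have hsq : IsSquare (algebraMap ℚ ℚ_[p] (NumberField.discr K : ℚ)) :=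
    X11b.isSquare_discr_padic_of_heegner K hK hHN p hpN
  have hpd : ¬ (p : ℤ) ∣ NumberField.discr K :=
    not_dvd_discr_of_split hK hp.out hp2 (SatisfiesHeegnerHypothesis.of_dvd hpN hHN)
  have hj : Wd.j = W.j := AdditivePotMult.j_of_model_twist hD0 ⟨Cd, hWd⟩
  have hΔ : padicValInt p Wd.minimalDiscriminantInt = padicValInt p W.minimalDiscriminantInt :=
    X11b.padicValInt_minimalDiscriminantInt_twist_eq W p hD0 hsq Cd hWd
  have hf : Additive.condExp Wd p = Additive.condExp W p :=
    condExp_twist_of_heegner_eq p W K hK hodd hpd Cd hWd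
  unfold Additive.SubSemistableTwist Additive.SubM Additive.SubGordTwo Additive.SubGord Additive.PotMult
    Additive.CondExpTwo Additive.semistabilityIndex at hS ⊢
  rw [hj, hΔ, hf]
  exact hS

/-- **`ClassX3` transports along the Heegner twist**: `E[p]` reducible and `p` additive for `E` ⟹
the same for every model `Wd` of `E^{(d_K)}` (`K` quadratic with the Heegner hypothesis for `N_E`;
`red_twist_of_quadratic`, `AdditivePotMult.addv_iff_of_twist`). [cite: SilvermanAEC2009, X.5 Cor. 5.4] -/
theorem classX3_twist_of_heegner (W : WeierstrassCurve ℚ) [W.IsElliptic] [W.IsGloballyMinimal]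
    (K : Type) [Field K] [NumberField K] (hK : IsImaginaryQuadratic K)
    (hHN : SatisfiesHeegnerHypothesis (W.conductorNorm ℤ) K) (hX : ClassX3 W p)
    {Wd : WeierstrassCurve ℚ} [Wd.IsElliptic] (Cd : VariableChange ℚ)
    (hWd : Cd • W.quadraticTwist (NumberField.discr K : ℚ) = Wd) : ClassX3 Wd p := by
  have hD0 : (NumberField.discr K : ℚ) ≠ 0 := by exact_mod_cast NumberField.discr_ne_zero K
  have hpN : p ∣ W.conductorNorm ℤ :=
    (W.dvd_conductorNorm_iff_not_hasGoodReductionAtPrime p).mpr hX.2.1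
  have hsq' : IsSquare (algebraMap ℚ ℚ_[p] (NumberField.discr K : ℚ)) :=
    X11b.isSquare_discr_padic_of_heegner K hK hHN p hpN
  have hsq : IsSquare (((NumberField.discr K : ℚ) : ℚ) : ℚ_[p]) := by simpa using hsq'
  exact ⟨red_twist_of_quadratic W p K hK.1 hX.1 Cd hWd,
    (AdditivePotMult.addv_iff_of_twist hD0 hsq Wd hWd).mpr hX.2⟩

end Summit.BirchSwinnertonDyer.BirchSwinnertonDyer.Theorems.SchneiderFree

/-! ### §2 The item -/

namespace Summit.BirchSwinnertonDyer.BirchSwinnertonDyer.Theorems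

open Literature.NumberTheory.EllipticCurves.KrizLi2019

/-- **Item `HeegnerTwistData` of route `SchneiderFreeAdditiveX3` holds**: Friedberg–Hoffstein with
prescribed splitting (`M = 2`), parity, Heegner points over `K`, Gross–Zagier and modularity give, for
every pair on the cells, a Heegner field `K` for `N_E` with odd `d_K`, `p ∤ #𝓞_K^×`, `L(E^{d_K},1) ≠ 0`,
a parametrisation datum with its (non-torsion) Heegner point, and a globally minimal rank-zero model of
the twist on the same cells — `SchneiderFree.HeegnerTwistDataManinAt W p`, with NO condition on the
parametrisation constant. [cite: FriedbergHoffstein1995, Thm. B]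
[cite: JetchevSkinnerWan2017, §7.4.1 (p. 30)] [cite: GrossZagier1986, Thm. I.(6.3)] -/
theorem schneiderFreeAdditiveX3_heegnerTwistData_proof :
    Summit.BirchSwinnertonDyer.BirchSwinnertonDyer.Theses.SchneiderFreeAdditiveX3.HeegnerTwistData := by
  intro hFH hpar hHP hGZ hmod _hmodD W _ _ p _ hr hp2 hX hS
  haveI hN0 : NeZero (W.conductorNorm ℤ) := ⟨W.conductorNorm_pos_holds.ne'⟩
  -- parity: `r_an = 1` is odd, so `w(E) = -1`
  have hw : W.rootNumber = -1 := by
    rcases W.rootNumber_eq_one_or with h | h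
    · exfalso
      have heven : Even W.analyticRank := (hpar W).mpr h
      rw [hr] at heven
      exact Nat.not_even_one heven
    · exact h
  -- Friedberg–Hoffstein with `M = 2`: a Heegner field for `N_E` with `2` split and `L(E^{d_K},1) ≠ 0`
  obtain ⟨K, _, _, hK, -, hHN, hH2, hLt⟩ := hFH W hw 2 two_ne_zero 0
  -- `p ∣ N_E` (additive), so `p` splits: `p ∤ d_K`, `p ∤ #𝓞_K^×`; `2` splits: `d_K` odd
  have hpN : p ∣ W.conductorNorm ℤ :=
    (W.dvd_conductorNorm_iff_not_hasGoodReductionAtPrime p).mpr hX.2.1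
  have hodd : Odd (NumberField.discr K) := by
    have h8 := Literature.SatisfiesHeegnerHypothesis.discr_emod_eight hK.1 hH2 (dvd_refl 2)
    rw [Int.odd_iff]; omega
  have hunit : ¬ p ∣ Units.torsionOrder K :=
    (X11b.Three.not_dvd_discr_and_not_dvd_torsionOrder_of_heegner hK hHN hp2 hpN).2
  -- the Heegner point over `K` and its data
  obtain ⟨P, Dt, H, ι, hP⟩ := hHP W K hK hHN
  -- non-torsion by Gross–Zagier: `L'(E/K,1) = L'(E,1) · L(E^{d_K},1) ≠ 0`
  have hL0 : W.entireLFunction 1 = 0 := entireLFunction_one_eq_zero_of_analyticRank_eq_one hr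
  obtain ⟨-, hderiv⟩ := leadingLCoeff_eq_deriv_of_analyticRank_eq_one hr
  have hprod := lDerivEK_eq_deriv_mul W K hmod hL0
  have hLK : LDerivEK W K ≠ 0 := by
    rw [hprod]; exact mul_ne_zero hderiv hLt
  have hnt : ¬ IsOfFinAddOrder P :=
    (lDerivEK_ne_zero_iff_not_isOfFinAddOrder W (W.conductorNorm ℤ) K (hGZ _ W K) hK hHN
      ⟨Dt, H, ι, hP⟩).mp hLK
  -- a globally minimal model of the twist, of analytic rank zero
  have hD0 : (NumberField.discr K : ℚ) ≠ 0 := by exact_mod_cast NumberField.discr_ne_zero K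
  haveI hEt : (W.quadraticTwist (NumberField.discr K : ℚ)).IsElliptic :=
    W.isElliptic_quadraticTwist hD0
  obtain ⟨Cd, hCd⟩ := hasGlobalMinimalModel_rat_holds (W.quadraticTwist (NumberField.discr K : ℚ))
  set Wd : WeierstrassCurve ℚ := Cd • W.quadraticTwist (NumberField.discr K : ℚ) with hWd_def
  haveI : Wd.IsGloballyMinimal := hCd
  have hWd : Cd • W.quadraticTwist (NumberField.discr K : ℚ) = Wd := rfl
  have hrt : (W.quadraticTwist (NumberField.discr K : ℚ)).analyticRank = 0 :=
    ((W.quadraticTwist _).analyticRank_eq_zero_iff_holds (hmod _)).2 hLt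
  have hrd : Wd.analyticRank = 0 := by rw [← hWd, analyticRank_smul, hrt]
  -- the twist lies on the same cells
  have hXd : ClassX3 Wd p := SchneiderFree.classX3_twist_of_heegner p W K hK hHN hX Cd hWd
  have hSd : Additive.SubSemistableTwist Wd p :=
    SchneiderFree.subSemistableTwist_twist_of_heegner p W hp2 K hK hodd hHN hX.2 Cd hWd hS
  exact ⟨W.conductorNorm ℤ, hN0, K, inferInstance, inferInstance, Dt, H, ι, P, Wd, inferInstance,
    hCd, rfl, hK, hodd, hunit, hHN, hLt, hP, hnt, ⟨Cd, hWd⟩, hrd, hXd, hSd⟩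

end Summit.BirchSwinnertonDyer.BirchSwinnertonDyer.Theorems

end
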